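import Literature.AlgebraicGeometry.Resolution.PointStepTrichotomy
import Literature.AlgebraicGeometry.Resolution.PointCentreFibreLineResidue
import HarnessLib

/-!
# The `τ = 1` point step of [CoP1] Prop. 4.4: the trichotomy with `k(x′) = k(x)[t̄]` (primed form)

Topic: `Literature/AlgebraicGeometry/Resolution`; sequel of `PointStepTrichotomy.lean`. The non-rational step
theorem of the F-71 line (res-inputs-p-8a, "B6-nr"; [CoP1] Lemma 4.5 (2), CJS Lemma 14.8) consumes, beyond the
eleven data of disjunct (iii) of `IsBlowup.pointStep_trichotomy_of_stalkTau_eq_one`, the fact that the residue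
field of the near point is generated by the residue of `t = u₂/u₁`: every `r ∈ k(x′)` is the residue of `G(t)`
for some `G ∈ 𝒪_{X,x}[T]` (`k(x′) = k(x)[T]/(P̄)`). Since `t` is bound existentially in (iii), this is supplied as
a PRIMED restatement `IsBlowup.pointStep_trichotomy_of_stalkTau_eq_one'` with a 12th conjunct in (iii) (the other
two disjuncts unchanged; there `k(x) → k(x′)` is onto). Proof = the proof of the unprimed theorem with the
ring-level export `pointCentre_chart_residueField_generated` / `chartSwitch_nonRational'`
(`PointCentreFibreLineResidue.lean`).

Everything is PROVED (no `sorry`, no definitions, no named facts); OURS. `hμ` is interface-only (unused). F-71 /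
T1 NOT proved; no summit statement proved. AI-written; weaker than expert review.

## Sources

* V. Cossart, O. Piltant, J. Algebra 320 (2008), Lemma 4.3 (5), Lemma 4.5 (2); proof of Prop. 4.4, p. 12. [CossartPiltant2008]
* V. Cossart, U. Jannsen, S. Saito, LNM 2270 (2020), Lemma 14.1, Lemma 14.8. [CossartJannsenSaito2020]
-/

noncomputable section

open CategoryTheory AlgebraicGeometry TopologicalSpace IsLocalRing

namespace Literature.AlgebraicGeometry.Resolution

universe u

open Scheme.IdealSheafData

variable {X X' : Scheme.{u}} {π : X' ⟶ X}

set_option maxHeartbeats 800000 in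
-- chart presentation of a stalk: large terms (as in `NearPointsPointCentreLineLocal`)
/-- **N2-σ′ — the `τ = 1` point-step trichotomy with `k(x′) = k(x)[t̄]` in the non-rational case** (primed
restatement of `IsBlowup.pointStep_trichotomy_of_stalkTau_eq_one`; disjunct (iii) carries a 12th conjunct): the near closed point `x′` is
(i)/(ii) rational in the `u₁`-chart (origin after a shear `u₂ ↦ u₂ − a u₁`, residue fields equal), or
(iii) non-rational in the `u₁`-chart (third parameter `P(u₂/u₁)`, `P̄` irreducible of degree `≥ 2`, with the
residue criterion), or (i′) the origin of the `u₂`-chart; in each case with generators of `𝔪_{x′}` and the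
weak transform's stalk as the ring colon. (`hμ` belongs to the agreed interface; the proof does not need it.)
[cite: CossartPiltant2008, Lemma 4.3 (5); proof of Prop. 4.4, p. 12] [cite: CossartJannsenSaito2020, Lemma 14.1] -/
theorem IsBlowup.pointStep_trichotomy_of_stalkTau_eq_one' [IsLocallyNoetherian X] [IsLocallyNoetherian X']
    {Y : Closeds X} (hπ : IsBlowup π (vanishingIdeal Y)) {J : X.IdealSheafData} {μ : ℕ} (hμ : 1 ≤ μ)
    {x' : X'} [IsRegularLocalRing (X.presheaf.stalk (π x'))] [IsRegularLocalRing (X'.presheaf.stalk x')]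
    (hd : (maximalIdeal (X.presheaf.stalk (π x'))).spanFinrank = 3)
    (hd' : (maximalIdeal (X'.presheaf.stalk x')).spanFinrank = 3)
    {c : Fin 3 → X.presheaf.stalk (π x')} (hc : Ideal.span (Set.range c) = maximalIdeal _)
    (hcY : Ideal.span (Set.range c) = stalkIdeal (vanishingIdeal Y) (π x'))
    (hτ : stalkTau J (π x') μ = 1) (had : ∀ i, i ≠ 0 → IsAdapted c (stalkIdeal J (π x')) μ i)
    (hnear : IsNear π (vanishingIdeal Y) J μ x') :
    -- (i)/(ii): rational in the `u₁`-chart — origin after the shear `u₂ ↦ u₂ − a u₁`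
    (∃ (a : X.presheaf.stalk (π x')) (c' : Fin 3 → X'.presheaf.stalk x'),
        c' 1 = (π.stalkMap x').hom (c 1) ∧
        (π.stalkMap x').hom (c 0) = (π.stalkMap x').hom (c 1) * c' 0 ∧
        (π.stalkMap x').hom (c 2 - a * c 1) = (π.stalkMap x').hom (c 1) * c' 2 ∧
        Ideal.span {c' 0, c' 1, c' 2} = maximalIdeal (X'.presheaf.stalk x') ∧
        Function.Surjective (ResidueField.map (π.stalkMap x').hom) ∧
        stalkIdeal (controlledTransform π (vanishingIdeal Y) J μ) x' =
          Submodule.colon ((stalkIdeal J (π x')).map (π.stalkMap x').hom)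
            ({(π.stalkMap x').hom (c 1) ^ μ} : Set (X'.presheaf.stalk x'))) ∨
    -- (iii): non-rational in the `u₁`-chart
    (∃ (t : X'.presheaf.stalk x') (P : Polynomial (X.presheaf.stalk (π x')))
        (c' : Fin 3 → X'.presheaf.stalk x'),
        c' 1 = (π.stalkMap x').hom (c 1) ∧
        (π.stalkMap x').hom (c 0) = (π.stalkMap x').hom (c 1) * c' 0 ∧
        (π.stalkMap x').hom (c 2) = (π.stalkMap x').hom (c 1) * t ∧
        P.Monic ∧ c' 2 = Polynomial.eval₂ (π.stalkMap x').hom t P ∧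
        2 ≤ (P.map (residue _)).natDegree ∧ Irreducible (P.map (residue _)) ∧
        (∀ G : Polynomial (X.presheaf.stalk (π x')),
          Polynomial.eval₂ (π.stalkMap x').hom t G ∈ maximalIdeal (X'.presheaf.stalk x') ↔
            P.map (residue _) ∣ G.map (residue _)) ∧
        Ideal.span {c' 0, c' 1, c' 2} = maximalIdeal (X'.presheaf.stalk x') ∧
        stalkIdeal (controlledTransform π (vanishingIdeal Y) J μ) x' =
          Submodule.colon ((stalkIdeal J (π x')).map (π.stalkMap x').hom)
            ({(π.stalkMap x').hom (c 1) ^ μ} : Set (X'.presheaf.stalk x')) ∧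
        (∀ r : ResidueField (X'.presheaf.stalk x'), ∃ G : Polynomial (X.presheaf.stalk (π x')),
          residue _ (Polynomial.eval₂ (π.stalkMap x').hom t G) = r)) ∨
    -- (i′): the origin of the `u₂`-chart
    (∃ c' : Fin 3 → X'.presheaf.stalk x',
        c' 2 = (π.stalkMap x').hom (c 2) ∧
        (π.stalkMap x').hom (c 0) = (π.stalkMap x').hom (c 2) * c' 0 ∧
        (π.stalkMap x').hom (c 1) = (π.stalkMap x').hom (c 2) * c' 1 ∧
        Ideal.span {c' 0, c' 1, c' 2} = maximalIdeal (X'.presheaf.stalk x') ∧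
        Function.Surjective (ResidueField.map (π.stalkMap x').hom) ∧
        stalkIdeal (controlledTransform π (vanishingIdeal Y) J μ) x' =
          Submodule.colon ((stalkIdeal J (π x')).map (π.stalkMap x').hom)
            ({(π.stalkMap x').hom (c 2) ^ μ} : Set (X'.presheaf.stalk x'))) := by
  classical
  have _hμ : 1 ≤ μ := hμ
  have hcm : ∀ i, c i ∈ maximalIdeal _ := fun i => hc ▸ Ideal.subset_span ⟨i, rfl⟩
  have hcq : IsQuasiRegular c := by
    have h := isQuasiRegular_rsop_comp hd c hc id Function.injective_id
    rwa [Function.comp_id] at h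
  -- STEP 1: the chart presentation of `x′`, its index `j ≠ 0`, and `e₀ ∈ 𝔴`
  obtain ⟨j, 𝔴, χ, hχ, hloc, h𝔴⟩ := hπ.exists_reesChart_stalk x' c hcY
  have h𝔴' : (maximalIdeal _).map (chartBase c j) ≤ 𝔴.asIdeal := by rw [← h𝔴]; exact Ideal.map_comap_le
  have hnearF : ∀ F : MvPolynomial (Fin 3) (X.presheaf.stalk (π x')), F.IsHomogeneous μ →
      MvPolynomial.eval c F ∈ stalkIdeal J (π x') →
      (algebraMap (chartRing c j) (Localization.AtPrime 𝔴.asIdeal) :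
          chartRing c j →+* Localization.AtPrime 𝔴.asIdeal)
          (MvPolynomial.eval₂Hom (chartBase c j) (fun i => chartGen c j i) F) ∈
        maximalIdeal (Localization.AtPrime 𝔴.asIdeal) ^ μ :=
    fun F hF hFJ => algebraMap_eval₂Hom_mem_pow_of_isNear hcY j 𝔴 χ hχ hloc hnear hF hFJ
  have hτc : hironakaTauAt c (stalkIdeal J (π x')) μ = 1 := by
    rw [← stalkTau_eq J (π x') μ hd c hc]; exact hτ
  obtain ⟨hj0, he0⟩ := ne_and_chartGen_mem_of_near_point_of_proj_mem_directrix hd c hc j 0 𝔴.asIdeal h𝔴'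
    hnearF (proj_mem_directrix_of_hironakaTauAt_eq_one c 0 hτc had)
  -- the relations `φ(c_i) = φ(c_j) · χ(e_i)` and the weak transform as a colon
  have hu : ∀ i, (π.stalkMap x').hom (c i) = (π.stalkMap x').hom (c j) * χ (chartGen c j i) :=
    fun i => by rw [← hχ, ← hχ, ← map_mul, ← reesChartBase_apply_eq_mul_chartGen c j i]
  have hcolon := stalkIdeal_controlledTransform_eq_colon_of_forall_eq_mul (π := π) (vanishingIdeal Y) J μ
    x' hcY j _ hu
  -- the third index `l` (`{0, j, l} = {0, 1, 2}`)
  obtain ⟨l, hl, hl0, hι⟩ : ∃ (l : Fin 3) (hl : l ≠ j), l ≠ 0 ∧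
      ∀ i : {i : Fin 3 // i ≠ j}, i.1 ≠ 0 → i = ⟨l, hl⟩ := by
    have key : ∀ j' : Fin 3, j' ≠ 0 → ∃ (l : Fin 3) (_ : l ≠ j'), l ≠ 0 ∧
        ∀ i : Fin 3, i ≠ j' → i ≠ 0 → i = l := by
      decide
    obtain ⟨l, hl, hl0, h⟩ := key j hj0
    exact ⟨l, hl, hl0, fun i hi => Subtype.ext (h i.1 i.2 hi)⟩
  -- STEP 2: the ring-level dichotomy on the chart `u_j ≠ 0`
  have heng := pointCentre_chart_dichotomy hd' hc hcq hj0 hl hl0 hι (π.stalkMap x').hom 𝔴.asIdeal χ hχ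
    hloc h𝔴 he0
  have hκ := pointCentre_chart_residueField_generated hd' hc hcq hj0 hl hl0 hι (π.stalkMap x').hom
    𝔴.asIdeal χ hχ hloc h𝔴 he0
  -- STEP 3: `j = 1` (the three `u₁`-chart shapes directly) or `j = 2` (origin, or switch to the `u₁`-chart)
  have hj12 : j = 1 ∨ j = 2 := by
    have key : ∀ j' : Fin 3, j' ≠ 0 → j' = 1 ∨ j' = 2 := by decide
    exact key j hj0
  rcases hj12 with rfl | rfl
  · have hl2 : l = 2 := by
      have key : ∀ l' : Fin 3, l' ≠ 1 → l' ≠ 0 → l' = 2 := by decide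
      exact key l hl hl0
    subst hl2
    rcases heng with ⟨a, -, hgen, hsurj⟩ | ⟨P, hPm, hP2, hPi, hcrit, hgen⟩
    · refine Or.inl ⟨a, ![χ (chartGen c 1 0), (π.stalkMap x').hom (c 1),
        χ (chartGen c 1 2) - (π.stalkMap x').hom a], rfl, hu 0, ?_, hgen, hsurj, hcolon⟩
      show (π.stalkMap x').hom (c 2 - a * c 1) =
        (π.stalkMap x').hom (c 1) * (χ (chartGen c 1 2) - (π.stalkMap x').hom a)
      rw [map_sub, map_mul, hu 2]; ring
    · exact Or.inr (Or.inl ⟨χ (chartGen c 1 2), P, ![χ (chartGen c 1 0), (π.stalkMap x').hom (c 1),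
        Polynomial.eval₂ (π.stalkMap x').hom (χ (chartGen c 1 2)) P], rfl, hu 0, hu 2, hPm, rfl, hP2, hPi,
        hcrit, hgen, hcolon, hκ⟩)
  · have hl1 : l = 1 := by
      have key : ∀ l' : Fin 3, l' ≠ 2 → l' ≠ 0 → l' = 1 := by decide
      exact key l hl hl0
    subst hl1
    rcases heng with ⟨a, ha, hgen, hsurj⟩ | ⟨P, hPm, hP2, hPi, hcrit, hgen⟩
    · rcases ha with rfl | haU
      · -- the origin of the `u₂`-chart
        refine Or.inr (Or.inr ⟨![χ (chartGen c 2 0), χ (chartGen c 2 1), (π.stalkMap x').hom (c 2)], rfl,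
          hu 0, hu 1, ?_, hsurj, hcolon⟩)
        show Ideal.span {χ (chartGen c 2 0), χ (chartGen c 2 1), (π.stalkMap x').hom (c 2)} = _
        rw [map_zero, sub_zero] at hgen
        rw [← hgen, Set.pair_comm (χ (chartGen c 2 1))]
      · -- rational, not the origin of the `u₂`-chart: switch to the `u₁`-chart
        obtain ⟨a', c', h1', h0', h2', hgen', hcol'⟩ := chartSwitch_rational (π.stalkMap x').hom haU (hu 0)
          (hu 1) hgen ((stalkIdeal J (π x')).map (π.stalkMap x').hom) μ
        exact Or.inl ⟨a', c', h1', h0', h2', hgen', hsurj, hcolon.trans hcol'⟩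
    · -- non-rational in the `u₂`-chart: switch to the `u₁`-chart (reciprocal polynomial)
      obtain ⟨t, P', c', h1', h0', ht, hP'm, hc2, hP'2, hP'i, hcrit', hgen', hcol', hκ'⟩ :=
        chartSwitch_nonRational' (π.stalkMap x').hom (hu 0) (hu 1) hPm hP2 hPi hcrit hgen hκ
          ((stalkIdeal J (π x')).map (π.stalkMap x').hom) μ
      exact Or.inr (Or.inl ⟨t, P', c', h1', h0', ht, hP'm, hc2, hP'2, hP'i, hcrit', hgen',
        hcolon.trans hcol', hκ'⟩)

end Literature.AlgebraicGeometry.Resolution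

end
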